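import Summits.QuantumFields.YangMills.Theorems.UnitScaleTiltProp7HermiteOffsets
import Summits.QuantumFields.YangMills.Theorems.UnitScaleTiltProp7LineOfTransportedFamily
import HarnessLib

/-!
# Route `UnitScaleTilt`, crux K1 «MinimiserStabilityRegPr» (stmt-QuantumFields-19200), route-R E′ path (α′), row LEMMA-H-CURVED — FILE 3b:
# THE COVARIANT HERMITE FACTOR ALONG ITS OWN LINE IS CURVATURE-FREE: with straight-line transports from the two centre lines,
# `Ad(W_{x,x+e_μ})(H^W_μ w)(x+e_μ) − 2(H^W_μ w)(x) + Ad(W_{x−e_μ,x})⁻¹(H^W_μ w)(x−e_μ) = (p(r+1) − 2p(r) + p(r−1))·(A(x) − B(x))` EXACTLY (interior `r`),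
# `A(x), B(x)` the two centre values transported to `x` — the matrix twin of ✓ `Prop7HermiteSecondDiff` §1–§2, no plaquette enters

Cell `ym3-torus`, D-0154 (3c) twin-width seat `ym-routeR-w1` (gen 5); row «routeR-w1 g5: LEMMA-H-CURVED» (namer ★ym-ust-19200-p1 g14, 2026-08-28 17:33Z), design memo
`DESIGN-FH3-routeRw1g5.md` (19200 evidence) §3 F-H3b.  THEOREMS ONLY (0 `def`, 0 `sorry`); `--supports stmt-QuantumFields-19200`, count-neutral.  YM₃ on T³ is a ladder rung
(R3), not the Clay problem; nothing here claims a stub, the crux, d = 4 or the mass gap.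

WHY.  The curved extension for LEMMA-H-curved (F-H1 ✓ `Prop7CentreBiharmonicDirichlet` needs ONE extension with small covariant Laplacian energy) transports the corner data
along `W`.  In the direction `μ` of a Hermite factor the transport runs along the `μ`-LINE through `x`: the lower centre value `w(x⌊μ⌋)` is brought to `x` by the line holonomy
`h⁻(x) = W([x⌊μ⌋ → r steps e_μ])` (as `Ad(h⁻)⁻¹`, the `B9Eq39Adjoint` convention `R(U)f(x+e_μ)` transports backwards along a bond), the upper one `w(x⌊μ⌋ + ℓe_μ)` by
`h⁺(x) = W([x → ℓ−r steps e_μ])` (as `Ad(h⁺)`).  Because the three points `x, x ± e_μ` lie on the SAME line, the covariant second difference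
`Ad(W_{x,μ})Φ(x+e_μ) − 2Φ(x) + Ad(W_{x−e_μ,μ})⁻¹Φ(x−e_μ)` (the `μ`-summand of `−Δ_W = −D*_WD_W`) sees only the LINE RECURSIONS `h⁺(x) = W_{x,μ}·h⁺(x+e_μ)`,
`h⁻(x+e_μ) = h⁻(x)·W_{x,μ}` (✓ `Prop7LineOfTransportedFamily.holAt_walk_replicate_succ` and its snoc twin, §1) — NO plaquette: the factor's own direction is
CURVATURE-FREE and the flat profile algebra of F-H2 carries over verbatim with `A(x) = Ad(h⁻(x))⁻¹w(c)`, `B(x) = Ad(h⁺(x))w(c⁺)` in place of `w(c), w(c⁺)`.  Curvature enters the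
curved extension only ACROSS directions (memo §1 (A) prism defects, (B) transport variation) — the other F-H3 files.

WHAT IS PROVED (ns `…Theorems.Prop7HermiteLineCovariant`; `SU(N)`, any `P`, level `j`).
* §1 line words (`holAt_append` is ✓ `T4Continuum.holAt_append`): `walkEnd_walk_replicate`, ★ `holAt_walk_replicate_snoc` (`W([c → t+1]) = W([c → t])·W(c + te_μ, μ)`), `iterate_shift_update`.
* §2 ★★ `secondDiff_line_interior_abstract` — the displayed identity for ABSTRACT transported values obeying the two line recursions (pure algebra: conjugation is linear),
  ★★ `secondDiff_line_knot_abstract` — the knot: `Φ(c±e_μ)` blend the neighbouring cells, and the covariant second difference at the centre is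
  `p(ℓ−1)·(Ad(h⁺(c))w(c⁺) − 2w(c) + Ad(h↓(c))⁻¹w(c⁻))` — the COVARIANT COARSE SECOND DIFFERENCE along the line with straight `ℓ`-step transports (`p(1) + p(ℓ−1) = 1`).
* §3 ★ `lineDown_recursion`, ★ `lineUp_recursion` — the two recursions for the concrete straight-line holonomies at offsets `r_μ` of ✓ `Prop7HermiteOffsets` (so §2 applies
  to `A(x) = Ad(W([x⌊μ⌋ → r]))⁻¹ w(x⌊μ⌋)`, `B(x) = Ad(W([x → ℓ−r])) w(x⌊μ⌋ + ℓe_μ)`).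
HONEST SCOPE.  Exact algebra of transports along one line; no estimate, no plaquette, nothing of Bałaban's beyond the cited letters.

References: T. Bałaban, CMP 98 (1985) 17–51 [Balaban1985Averaging] ((8) p.18, (58) p.27 — transports along straight contours); CMP 99 (1985) 389–434
[Balaban1985BackgroundPropagators] ((3.3), (3.8) pp.390–392 — `D_W`, `D*_W`); CMP 95 (1984) 17–40 [Balaban1984PropagatorsI] ((1.18) p.20).
-/

set_option autoImplicit false

noncomputable section

open scoped BigOperators Matrix.Norms.L2Operator

namespace Summit.QuantumFields.YangMills.Theorems.Prop7HermiteLineCovariant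

open Literature.MathematicalPhysics.QuantumFieldTheory.Balaban1983to89
open T4Continuum BlockAveraging
open Summit.QuantumFields.YangMills.Theorems.Prop7LineOfTransportedFamily (holAt_walk_replicate_succ)
open Summit.QuantumFields.YangMills.Theorems.Prop7HolRatioPerStep (coe_mul_star_self coe_star_mul_self)

variable {P : Params} {j : ℕ} {n : Type*} [Fintype n] [DecidableEq n]

/-! ## §1 Straight line words -/

section Words

variable {G : Type*} [GaugeGroup G]

/-- the end of the straight walk `[x → t steps e_μ]` is `x + te_μ`. [folklore] -/
theorem walkEnd_walk_replicate (x : Site P j) (μ : Fin P.d) : ∀ t : ℕ, walkEnd x (List.replicate t (μ, true)) = (fun z : Site P j => z.shift μ)^[t] x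
  | 0 => rfl
  | t + 1 => by
    rw [List.replicate_succ, walkEnd, walkEnd_walk_replicate (x.shift μ) μ t, Function.iterate_succ_apply]

/-- ★ the snoc recursion: `W([c → t+1 steps]) = W([c → t steps])·W(c + te_μ, μ)`. [cite: Balaban1985Averaging, (58) p.27] -/
theorem holAt_walk_replicate_snoc (U : GaugeField P j G) (c : Site P j) (μ : Fin P.d) (t : ℕ) :
    holAt U (walk c (List.replicate (t + 1) (μ, true))) = holAt U (walk c (List.replicate t (μ, true))) * U ⟨(fun z : Site P j => z.shift μ)^[t] c, μ⟩ := by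
  rw [List.replicate_succ', walk_append, holAt_append, walkEnd_walk_replicate]
  simp [walk, holAt_cons, holAt_nil]

/-- iterating the shift from a translated point: `(· + e_μ)^[t] (x − a e_μ … ) = x + (t − a)e_μ`, in update form. [folklore] -/
theorem iterate_shift_update (x : Site P j) (μ : Fin P.d) (a : ZMod (P.sitesPerDir j)) :
    ∀ t : ℕ, (fun z : Site P j => z.shift μ)^[t] (Function.update x μ a) = Function.update x μ (a + t)
  | 0 => by simp
  | t + 1 => by
    rw [Function.iterate_succ_apply', iterate_shift_update x μ a t]
    funext κ
    by_cases hκ : κ = μ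
    · subst hκ; simp [Site.shift, add_assoc]
    · simp [Site.shift, hκ]

end Words

/-! ## §2 The covariant second difference along the line: abstract transported values -/

section Abstract

/-- ★★ **INTERIOR**: if the transported values obey the line recursions `W·A⁺·W* = A`, `W·B⁺·W* = B` (forward neighbour) and `W₋*·A⁻·W₋ = A`, `W₋*·B⁻·W₋ = B` (backward
neighbour), then `Ad(W)(p⁺A⁺ + (1−p⁺)B⁺) − 2(pA + (1−p)B) + Ad(W₋)⁻¹(p⁻A⁻ + (1−p⁻)B⁻) = (p⁺ − 2p + p⁻)·(A − B)` — no plaquette. [cite: Balaban1985BackgroundPropagators, (3.3) p.390] -/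
theorem secondDiff_line_interior_abstract (W Wm : Matrix.specialUnitaryGroup n ℂ) (A B Ap Bp Am Bm : Matrix n n ℂ) (p pp pm : ℝ)
    (hAp : (W : Matrix n n ℂ) * Ap * star (W : Matrix n n ℂ) = A) (hBp : (W : Matrix n n ℂ) * Bp * star (W : Matrix n n ℂ) = B)
    (hAm : star (Wm : Matrix n n ℂ) * Am * (Wm : Matrix n n ℂ) = A) (hBm : star (Wm : Matrix n n ℂ) * Bm * (Wm : Matrix n n ℂ) = B) :
    (W : Matrix n n ℂ) * ((pp : ℂ) • Ap + ((1 - pp : ℝ) : ℂ) • Bp) * star (W : Matrix n n ℂ)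
      - 2 • ((p : ℂ) • A + ((1 - p : ℝ) : ℂ) • B)
      + star (Wm : Matrix n n ℂ) * ((pm : ℂ) • Am + ((1 - pm : ℝ) : ℂ) • Bm) * (Wm : Matrix n n ℂ)
      = ((pp - 2 * p + pm : ℝ) : ℂ) • (A - B) := by
  rw [Matrix.mul_add, Matrix.add_mul, Matrix.mul_smul, Matrix.smul_mul, Matrix.mul_smul, Matrix.smul_mul, hAp, hBp,
    Matrix.mul_add, Matrix.add_mul, Matrix.mul_smul, Matrix.smul_mul, Matrix.mul_smul, Matrix.smul_mul, hAm, hBm]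
  push_cast
  simp only [sub_smul, smul_sub, one_smul, add_smul, mul_smul, two_smul]
  abel

/-- ★★ **KNOT** (`x = c` on a centre line, offsets `0` at `c`, `1` at `c + e_μ`, `ℓ−1` at `c − e_μ`, `p(0) = 1`): with `B⁺` transported to `c` as `Ad(W_c)B⁺ = B`
(the upper centre value brought down the whole line), `A⁺ = W_c*·w(c)·W_c` (so `Ad(W_c)A⁺ = w(c)`), and below: `Ad(W₋)⁻¹A⁻ = A↓` (the lower cell's lower value brought
up the whole line), `Ad(W₋)⁻¹B⁻ = w(c)`: the covariant second difference at the centre is `(p(1) − 1 − p(ℓ−1) + 1)·…` — precisely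
`Ad(W_c)Φ⁺ − 2w(c) + Ad(W₋)⁻¹Φ⁻ = (1 − p(1))·(B − w(c)) − p(ℓ−1)·(w(c) − A↓)`, i.e. `η·(B − 2w(c) + A↓)` when `p(1) + p(ℓ−1) = 1`, `η = p(ℓ−1)`.
[cite: Balaban1985BackgroundPropagators, (3.3) p.390] -/
theorem secondDiff_line_knot_abstract (W Wm : Matrix.specialUnitaryGroup n ℂ) (wc B Adown Ap Bp Am Bm : Matrix n n ℂ) (p1 pk : ℝ)
    (hAp : (W : Matrix n n ℂ) * Ap * star (W : Matrix n n ℂ) = wc) (hBp : (W : Matrix n n ℂ) * Bp * star (W : Matrix n n ℂ) = B)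
    (hAm : star (Wm : Matrix n n ℂ) * Am * (Wm : Matrix n n ℂ) = Adown) (hBm : star (Wm : Matrix n n ℂ) * Bm * (Wm : Matrix n n ℂ) = wc)
    (hpc : p1 + pk = 1) :
    (W : Matrix n n ℂ) * ((p1 : ℂ) • Ap + ((1 - p1 : ℝ) : ℂ) • Bp) * star (W : Matrix n n ℂ)
      - 2 • wc
      + star (Wm : Matrix n n ℂ) * ((pk : ℂ) • Am + ((1 - pk : ℝ) : ℂ) • Bm) * (Wm : Matrix n n ℂ)
      = ((pk : ℝ) : ℂ) • (B - 2 • wc + Adown) := by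
  have hp1 : p1 = 1 - pk := by linarith
  subst hp1
  rw [Matrix.mul_add, Matrix.add_mul, Matrix.mul_smul, Matrix.smul_mul, Matrix.mul_smul, Matrix.smul_mul, hAp, hBp,
    Matrix.mul_add, Matrix.add_mul, Matrix.mul_smul, Matrix.smul_mul, Matrix.mul_smul, Matrix.smul_mul, hAm, hBm]
  push_cast
  simp only [sub_smul, smul_sub, one_smul, smul_add, two_smul, sub_sub_cancel]
  abel

end Abstract

/-! ## §3 The concrete straight-line holonomies obey the recursions -/

section Concrete

variable [Nonempty n]

/-- ★ **UP-RECURSION**: `h⁺(x) = W(x,μ)·h⁺(x + e_μ)` for `h⁺(y) = W([y → (ℓ − r_y) steps e_μ])` when `r_{x+e_μ} = r_x + 1 ≤ ℓ` (interior), hence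
`Ad(W(x,μ))(Ad(h⁺(x+e_μ))X) = Ad(h⁺(x))X`. [cite: Balaban1985Averaging, (58) p.27] -/
theorem lineUp_recursion (Wf : GaugeField P j (Matrix.specialUnitaryGroup n ℂ)) (x : Site P j) (μ : Fin P.d) (s : ℕ) (X : Matrix n n ℂ) :
    ((Wf ⟨x, μ⟩ : Matrix.specialUnitaryGroup n ℂ) : Matrix n n ℂ)
        * (((holAt Wf (walk (x.shift μ) (List.replicate s (μ, true))) : Matrix.specialUnitaryGroup n ℂ) : Matrix n n ℂ) * X
            * star ((holAt Wf (walk (x.shift μ) (List.replicate s (μ, true))) : Matrix.specialUnitaryGroup n ℂ) : Matrix n n ℂ))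
        * star ((Wf ⟨x, μ⟩ : Matrix.specialUnitaryGroup n ℂ) : Matrix n n ℂ)
      = ((holAt Wf (walk x (List.replicate (s + 1) (μ, true))) : Matrix.specialUnitaryGroup n ℂ) : Matrix n n ℂ) * X
          * star ((holAt Wf (walk x (List.replicate (s + 1) (μ, true))) : Matrix.specialUnitaryGroup n ℂ) : Matrix n n ℂ) := by
  rw [holAt_walk_replicate_succ]
  push_cast
  simp only [star_mul, Matrix.mul_assoc]

/-- ★ **DOWN-RECURSION**: `h⁻(x + e_μ) = h⁻(x)·W(x,μ)` for `h⁻(y) = W([y⌊μ⌋ → r_y steps e_μ])` with `x = c + te_μ`, hence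
`Ad(W(x,μ))(Ad(h⁻(x+e_μ))⁻¹X) = Ad(h⁻(x))⁻¹X`. [cite: Balaban1985Averaging, (58) p.27] -/
theorem lineDown_recursion (Wf : GaugeField P j (Matrix.specialUnitaryGroup n ℂ)) (c : Site P j) (μ : Fin P.d) (t : ℕ) (X : Matrix n n ℂ) :
    ((Wf ⟨(fun z : Site P j => z.shift μ)^[t] c, μ⟩ : Matrix.specialUnitaryGroup n ℂ) : Matrix n n ℂ)
        * (star ((holAt Wf (walk c (List.replicate (t + 1) (μ, true))) : Matrix.specialUnitaryGroup n ℂ) : Matrix n n ℂ) * X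
            * ((holAt Wf (walk c (List.replicate (t + 1) (μ, true))) : Matrix.specialUnitaryGroup n ℂ) : Matrix n n ℂ))
        * star ((Wf ⟨(fun z : Site P j => z.shift μ)^[t] c, μ⟩ : Matrix.specialUnitaryGroup n ℂ) : Matrix n n ℂ)
      = star ((holAt Wf (walk c (List.replicate t (μ, true))) : Matrix.specialUnitaryGroup n ℂ) : Matrix n n ℂ) * X
          * ((holAt Wf (walk c (List.replicate t (μ, true))) : Matrix.specialUnitaryGroup n ℂ) : Matrix n n ℂ) := by
  rw [holAt_walk_replicate_snoc]
  set h := holAt Wf (walk c (List.replicate t (μ, true)))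
  set g := Wf ⟨(fun z : Site P j => z.shift μ)^[t] c, μ⟩
  push_cast
  rw [star_mul]
  have h1 : (g : Matrix n n ℂ) * (star (g : Matrix n n ℂ) * star (h : Matrix n n ℂ) * X * ((h : Matrix n n ℂ) * (g : Matrix n n ℂ))) * star (g : Matrix n n ℂ)
      = ((g : Matrix n n ℂ) * star (g : Matrix n n ℂ)) * (star (h : Matrix n n ℂ) * X * (h : Matrix n n ℂ)) * ((g : Matrix n n ℂ) * star (g : Matrix n n ℂ)) := by
    simp only [Matrix.mul_assoc]
  rw [h1, coe_mul_star_self, Matrix.one_mul, Matrix.mul_one]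

omit [Nonempty n] in
/-- the backward-neighbour forms: `Ad(W(x−e_μ,μ))⁻¹(Ad(h⁺(x−e_μ))X) = Ad(h⁺'(x))X` where `h⁺(x − e_μ) = W(x−e_μ,μ)·h⁺'` — i.e. `W₋*·(W₋ h X h* W₋*)·W₋ = h X h*`.
[cite: Balaban1985Averaging, (8) p.18] -/
theorem conj_star_cancel (Wm : Matrix.specialUnitaryGroup n ℂ) (Y : Matrix n n ℂ) :
    star (Wm : Matrix n n ℂ) * ((Wm : Matrix n n ℂ) * Y * star (Wm : Matrix n n ℂ)) * (Wm : Matrix n n ℂ) = Y := by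
  have h1 : star (Wm : Matrix n n ℂ) * ((Wm : Matrix n n ℂ) * Y * star (Wm : Matrix n n ℂ)) * (Wm : Matrix n n ℂ)
      = (star (Wm : Matrix n n ℂ) * (Wm : Matrix n n ℂ)) * Y * (star (Wm : Matrix n n ℂ) * (Wm : Matrix n n ℂ)) := by
    simp only [Matrix.mul_assoc]
  rw [h1, coe_star_mul_self, Matrix.one_mul, Matrix.mul_one]

end Concrete

end Summit.QuantumFields.YangMills.Theorems.Prop7HermiteLineCovariant

end
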